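import Summits.Schanuel.Schanuel.Theorems.SoloInformedNesterenkoDoor

/-!
# Proposition BD (i) — a relation caps the dimension of a box; door (N) graded by bidegree

Solo programme `solo-Schanuel-informed` (verdict NO PATH unchanged; a verdict-neutral sharpening
of door (N) of `SoloInformedNesterenkoDoor`; companion `SoloInformedBoxFloor`).  Write
`Box_d(x) = {∏ᵢ xᵢ^{fᵢ} : 0 ≤ fᵢ ≤ d}` for the box of `(d+1)ⁿ` monomials at `x ∈ ℝⁿ`
(`boxMonomial x d`) and `dim Box_d(x)` for the `ℚ`-dimension of its span.

## Statements (all sorry-free)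

* §1 `box_linearIndependent_iff_forall_eq_zero` — `Box_d(x)` is `ℚ`-free iff no nonzero
  `P ∈ ℚ[X₁,…,Xₙ]` with all partial degrees `≤ d` vanishes at `x` (`eq_sum_box_monomial`,
  `aeval_eq_sum_box`: a polynomial of partial degrees `≤ d` is the sum of its box terms).
* §2 CAP `finrank_span_box_add_le_of_relation` — a nonzero relation `F(x) = 0` of multidegree
  `≤ a ≤ (d,…,d)` forces `dim Box_d(x) + ∏ᵢ (d + 1 − aᵢ) ≤ (d+1)ⁿ`: the multiples `F·Xʰ`, `h` in
  the sub-box `∏ [0, d − aᵢ]`, are `∏ (d+1−aᵢ)` independent relations inside the box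
  (rank–nullity for `Fintype.linearCombination ℚ (boxMonomial x d)` and the injective
  `relationMap`).  At `n = 2`, bidegree `(a, b)`: `dim Box_d ≤ (a+b)(d+1) − ab`.
* §4 DOORS — `eq_zero_of_box_nesterenkoData` (any `n`: Nesterenko data on `Box_d(x)` with
  `(d+1)ⁿ − ∏ (d+1−aᵢ) < 1 + τ` exclude relations of multidegree `≤ a`),
  `eq_zero_of_box_nesterenkoData_two` (threshold `(a+b)(d+1) − ab`),
  `bilinearFloor_of_box_nesterenkoData` (**`τ_d > 2d` on ONE box `Box_d(e,π)`, any `d ≥ 1`,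
  gives `BilinearFloor`**), `expOnePiAlgebraicIndependent_of_graded_nesterenkoData`
  (`e ⟂ π` from: for every bidegree `(a,b)` some box beyond the `(a,b)`-threshold).

## Reading

Door (N)(a′) of the companion file asked for a joint family of exponent `τ > 2` on the four
numbers `Box_1(e,π) = (1, e, π, eπ)`; door (N)(b) asked `τ_d > (d+1)² − 2` on `Box_d`.  This file
interpolates by bidegree: on `Box_d` a relation of bidegree `≤ (a,b)` is excluded as soon as
`1 + τ_d > (a+b)(d+1) − ab`, because such a relation would cap the dimension (§2) while the
criterion floors it at `1 + τ_d`.  For the bilinear floor (`(a,b) = (1,1)`) the threshold is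
`τ_d > 2d` on any one box, against the generic (Dirichlet) exponent `(d+1)² − 1` of `(d+1)²`
numbers: the required fraction of the generic exponent is `2d/((d+1)² − 1) = 2/(d+2)`
(`d = 1, 2, 3, 10`: `0.667, 0.5, 0.4, 0.167`), against `((d+1)² − 2)/((d+1)² − 1) → 1` for
door (b).  What is NOT here: no Nesterenko data on any `Box_d(e,π)` with `τ_d > 2d` is known; the
file proves implications only.

## References

* [Nesterenko1985] Yu. V. Nesterenko, *On the linear independence of numbers*, Vestnik Moskov.
  Univ. Ser. I (1985), no. 1, 46–49 (Moscow Univ. Math. Bull. 40 (1985), 69–74) — the criterion, in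
  the tree as `Literature.NumberTheory.Transcendental.nesterenko_criterion` (exact-rate form).
-/

noncomputable section

open Filter Topology Finset
open Literature.NumberTheory.Transcendental (ExpOnePiAlgebraicIndependent)

namespace Summit.Schanuel.Schanuel.Theorems

/-! ### §0 Sums of monomials with distinct exponents (bookkeeping) -/

section Monomials

variable {n : ℕ} {κ : Type*} [Fintype κ]

/-- Coefficient extraction from a sum of monomials with distinct exponents. -/
theorem coeff_sum_monomial_of_injective {E : κ → (Fin n →₀ ℕ)} (hE : Function.Injective E)
    (c : κ → ℚ) (k : κ) :
    MvPolynomial.coeff (E k) (∑ k', MvPolynomial.monomial (E k') (c k')) = c k := by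
  classical
  rw [MvPolynomial.coeff_sum]
  simp [MvPolynomial.coeff_monomial, hE.eq_iff]

/-- A sum of monomials whose exponents all miss `m` has zero `m`-coefficient. -/
theorem coeff_sum_monomial_eq_zero (E : κ → (Fin n →₀ ℕ)) (c : κ → ℚ) {m : Fin n →₀ ℕ}
    (hm : ∀ k, E k ≠ m) :
    MvPolynomial.coeff m (∑ k, MvPolynomial.monomial (E k) (c k)) = 0 := by
  classical
  rw [MvPolynomial.coeff_sum]
  exact Finset.sum_eq_zero fun k _ => by simp [MvPolynomial.coeff_monomial, hm k]

/-- Partial degrees of a sum of monomials are bounded by those of the exponents used. -/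
theorem degreeOf_sum_monomial_le (E : κ → (Fin n →₀ ℕ)) (c : κ → ℚ) {i : Fin n} {b : ℕ}
    (hb : ∀ k, E k i ≤ b) :
    MvPolynomial.degreeOf i (∑ k, MvPolynomial.monomial (E k) (c k)) ≤ b := by
  classical
  rw [MvPolynomial.degreeOf_le_iff]
  intro m hm
  by_contra h
  refine (MvPolynomial.mem_support_iff.mp hm) (coeff_sum_monomial_eq_zero E c fun k hk => ?_)
  have := hb k
  rw [hk] at this
  omega

end Monomials

/-! ### §1 Relations of bounded multidegree versus dependence of the box -/

section BoxAlgebra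

variable {n : ℕ}

/-- A polynomial all of whose partial degrees are `≤ d` is the sum of its box terms. -/
theorem eq_sum_box_monomial (d : ℕ) {P : MvPolynomial (Fin n) ℚ} (hP : ∀ i, P.degreeOf i ≤ d) :
    P = ∑ f : Fin n → Fin (d + 1), MvPolynomial.monomial (boxExp d f) (P.coeff (boxExp d f)) := by
  classical
  ext m
  by_cases hm : ∀ i, m i ≤ d
  · obtain ⟨f, rfl⟩ := exists_boxExp_eq d hm
    exact (coeff_sum_monomial_of_injective (boxExp_injective d)
      (fun f' => P.coeff (boxExp d f')) f).symm
  · push Not at hm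
    obtain ⟨i, hi⟩ := hm
    rw [coeff_sum_monomial_eq_zero (boxExp d) _ fun f hf => ?_]
    · by_contra hc
      have := (MvPolynomial.monomial_le_degreeOf i (MvPolynomial.mem_support_iff.mpr hc)).trans
        (hP i)
      omega
    · have h1 : (boxExp d f) i = m i := by rw [hf]
      rw [boxExp_apply] at h1
      have := (f i).is_lt
      omega

/-- The value at `x` of a polynomial of partial degrees `≤ d` is the `ℚ`-combination of the box
`Box_d(x)` with its box coefficients. -/
theorem aeval_eq_sum_box (x : Fin n → ℝ) (d : ℕ) {P : MvPolynomial (Fin n) ℚ}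
    (hP : ∀ i, P.degreeOf i ≤ d) :
    MvPolynomial.aeval x P =
      ∑ f : Fin n → Fin (d + 1), P.coeff (boxExp d f) • boxMonomial x d f := by
  conv_lhs => rw [eq_sum_box_monomial d hP]
  rw [map_sum]
  simp only [aeval_monomial_boxExp, Rat.smul_def]

/-- A polynomial of partial degrees `≤ d` with all box coefficients zero is zero. -/
theorem eq_zero_of_forall_coeff_boxExp (d : ℕ) {P : MvPolynomial (Fin n) ℚ}
    (hP : ∀ i, P.degreeOf i ≤ d) (h : ∀ f : Fin n → Fin (d + 1), P.coeff (boxExp d f) = 0) :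
    P = 0 := by
  rw [eq_sum_box_monomial d hP]
  simp [h]

/-- **Relations ⟷ box dependence.** `Box_d(x)` is `ℚ`-linearly independent iff no nonzero
polynomial with all partial degrees `≤ d` vanishes at `x`. -/
theorem box_linearIndependent_iff_forall_eq_zero (x : Fin n → ℝ) (d : ℕ) :
    LinearIndependent ℚ (boxMonomial x d) ↔
      ∀ P : MvPolynomial (Fin n) ℚ, (∀ i, P.degreeOf i ≤ d) →
        MvPolynomial.aeval x P = 0 → P = 0 := by
  classical
  rw [Fintype.linearIndependent_iff]
  constructor
  · intro h P hP hPx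
    refine eq_zero_of_forall_coeff_boxExp d hP (h _ ?_)
    rw [← aeval_eq_sum_box x d hP, hPx]
  · intro h g hg f
    have hQd : ∀ i, (∑ f', MvPolynomial.monomial (boxExp d f') (g f')).degreeOf i ≤ d :=
      fun i => degreeOf_sum_monomial_le (boxExp d) g fun f' => by
        rw [boxExp_apply]; exact Nat.le_of_lt_succ (f' i).is_lt
    have hQx : MvPolynomial.aeval x (∑ f', MvPolynomial.monomial (boxExp d f') (g f')) = 0 := by
      rw [map_sum]
      simpa only [aeval_monomial_boxExp, Rat.smul_def] using hg
    have hQ0 := h _ hQd hQx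
    have hc := coeff_sum_monomial_of_injective (boxExp_injective d) g f
    rw [hQ0, MvPolynomial.coeff_zero] at hc
    exact hc.symm

/-! ### §2 The cap: a relation of small multidegree bounds the dimension of the box -/

/-- The box-coefficient vector of a polynomial, as a `ℚ`-linear map. -/
def boxCoeff (d : ℕ) : MvPolynomial (Fin n) ℚ →ₗ[ℚ] ((Fin n → Fin (d + 1)) → ℚ) where
  toFun P f := P.coeff (boxExp d f)
  map_add' P Q := by funext f; simp
  map_smul' r P := by funext f; simp [MvPolynomial.coeff_smul]

/-- `boxCoeff` evaluates to the box coefficient. -/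
@[simp] theorem boxCoeff_apply (d : ℕ) (P : MvPolynomial (Fin n) ℚ) (f : Fin n → Fin (d + 1)) :
    boxCoeff d P f = P.coeff (boxExp d f) := rfl

/-- The box combination with the box coefficients of `P` is `P(x)` (partial degrees `≤ d`). -/
theorem linearCombination_boxCoeff (x : Fin n → ℝ) (d : ℕ) {P : MvPolynomial (Fin n) ℚ}
    (hP : ∀ i, P.degreeOf i ≤ d) :
    Fintype.linearCombination ℚ (boxMonomial x d) (boxCoeff d P) = MvPolynomial.aeval x P := by
  rw [Fintype.linearCombination_apply, aeval_eq_sum_box x d hP]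
  rfl

/-- The exponent vector of a sub-box index `h ∈ ∏ᵢ [0, d − aᵢ]`. -/
def subboxExp (d : ℕ) (a : Fin n → ℕ) (h : (i : Fin n) → Fin (d + 1 - a i)) : Fin n →₀ ℕ :=
  Finsupp.equivFunOnFinite.symm fun i => (h i : ℕ)

/-- The exponent vector of a sub-box index has the index's entries. -/
@[simp] theorem subboxExp_apply (d : ℕ) (a : Fin n → ℕ) (h : (i : Fin n) → Fin (d + 1 - a i))
    (i : Fin n) : subboxExp d a h i = h i := by
  simp [subboxExp]

/-- Distinct sub-box indices have distinct exponent vectors. -/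
theorem subboxExp_injective (d : ℕ) (a : Fin n → ℕ) :
    Function.Injective (subboxExp (n := n) d a) := by
  intro h h' e
  funext i
  have hi := congrArg (fun m : Fin n →₀ ℕ => m i) e
  simp only [subboxExp_apply] at hi
  exact Fin.ext hi

/-- The polynomial with a given sub-box coefficient vector, as a `ℚ`-linear map. -/
def subboxPoly (d : ℕ) (a : Fin n → ℕ) :
    (((i : Fin n) → Fin (d + 1 - a i)) → ℚ) →ₗ[ℚ] MvPolynomial (Fin n) ℚ where
  toFun c := ∑ h, MvPolynomial.monomial (subboxExp d a h) (c h)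
  map_add' c c' := by simp [Finset.sum_add_distrib]
  map_smul' r c := by simp [Finset.smul_sum, MvPolynomial.smul_monomial]

/-- `subboxPoly` unfolded. -/
theorem subboxPoly_apply (d : ℕ) (a : Fin n → ℕ) (c : ((i : Fin n) → Fin (d + 1 - a i)) → ℚ) :
    subboxPoly d a c = ∑ h, MvPolynomial.monomial (subboxExp d a h) (c h) := rfl

/-- A sub-box polynomial has partial degrees `≤ d − aᵢ`. -/
theorem degreeOf_subboxPoly_le (d : ℕ) (a : Fin n → ℕ)
    (c : ((i : Fin n) → Fin (d + 1 - a i)) → ℚ) (i : Fin n) :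
    (subboxPoly d a c).degreeOf i ≤ d - a i :=
  degreeOf_sum_monomial_le (subboxExp d a) c fun h => by
    rw [subboxExp_apply]; have := (h i).is_lt; omega

/-- The sub-box polynomial determines its coefficient vector. -/
theorem subboxPoly_eq_zero_iff (d : ℕ) (a : Fin n → ℕ)
    (c : ((i : Fin n) → Fin (d + 1 - a i)) → ℚ) : subboxPoly d a c = 0 ↔ c = 0 := by
  refine ⟨fun h0 => ?_, fun h0 => by rw [h0, map_zero]⟩
  funext h
  have hc := coeff_sum_monomial_of_injective (subboxExp_injective d a) c h
  rw [← subboxPoly_apply, h0, MvPolynomial.coeff_zero] at hc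
  exact hc.symm

/-- **The relation map** of `F` on the box `d` with margin `a`: a sub-box coefficient vector `c`
goes to the box-coefficient vector of `F · (sub-box polynomial of c)`. -/
def relationMap (d : ℕ) (a : Fin n → ℕ) (F : MvPolynomial (Fin n) ℚ) :
    (((i : Fin n) → Fin (d + 1 - a i)) → ℚ) →ₗ[ℚ] ((Fin n → Fin (d + 1)) → ℚ) :=
  boxCoeff d ∘ₗ LinearMap.mulLeft ℚ F ∘ₗ subboxPoly d a

/-- `relationMap` unfolded. -/
theorem relationMap_apply (d : ℕ) (a : Fin n → ℕ) (F : MvPolynomial (Fin n) ℚ)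
    (c : ((i : Fin n) → Fin (d + 1 - a i)) → ℚ) :
    relationMap d a F c = boxCoeff d (F * subboxPoly d a c) := rfl

/-- If `F` has multidegree `≤ a ≤ (d,…,d)`, the products `F · (sub-box polynomial)` stay in the
box. -/
theorem degreeOf_mul_subboxPoly_le {d : ℕ} {a : Fin n → ℕ} (had : ∀ i, a i ≤ d)
    {F : MvPolynomial (Fin n) ℚ} (hFa : ∀ i, F.degreeOf i ≤ a i)
    (c : ((i : Fin n) → Fin (d + 1 - a i)) → ℚ) (i : Fin n) :
    (F * subboxPoly d a c).degreeOf i ≤ d :=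
  (MvPolynomial.degreeOf_mul_le i _ _).trans (by
    have h1 := hFa i
    have h2 := degreeOf_subboxPoly_le d a c i
    have h3 := had i
    omega)

/-- The relation map of a relation `F(x) = 0` lands in the kernel of the box combination. -/
theorem relationMap_mem_ker {x : Fin n → ℝ} {d : ℕ} {a : Fin n → ℕ} (had : ∀ i, a i ≤ d)
    {F : MvPolynomial (Fin n) ℚ} (hFa : ∀ i, F.degreeOf i ≤ a i)
    (hFx : MvPolynomial.aeval x F = 0) (c : ((i : Fin n) → Fin (d + 1 - a i)) → ℚ) :
    relationMap d a F c ∈ LinearMap.ker (Fintype.linearCombination ℚ (boxMonomial x d)) := by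
  rw [LinearMap.mem_ker, relationMap_apply,
    linearCombination_boxCoeff x d (degreeOf_mul_subboxPoly_le had hFa c), map_mul, hFx, zero_mul]

/-- The relation map of a NONZERO `F` (multidegree `≤ a ≤ d`) is injective. -/
theorem relationMap_injective {d : ℕ} {a : Fin n → ℕ} (had : ∀ i, a i ≤ d)
    {F : MvPolynomial (Fin n) ℚ} (hF : F ≠ 0) (hFa : ∀ i, F.degreeOf i ≤ a i) :
    Function.Injective (relationMap d a F) := by
  rw [injective_iff_map_eq_zero]
  intro c hc
  have h1 : F * subboxPoly d a c = 0 :=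
    eq_zero_of_forall_coeff_boxExp d (degreeOf_mul_subboxPoly_le had hFa c) fun f =>
      congrFun hc f
  exact (subboxPoly_eq_zero_iff d a c).mp ((mul_eq_zero.mp h1).resolve_left hF)

/-- **Proposition BD, the cap.**  A nonzero relation `F(x) = 0` of multidegree `≤ a` with
`a ≤ (d,…,d)` gives `dim_ℚ ⟨Box_d(x)⟩ + ∏ᵢ (d + 1 − aᵢ) ≤ (d + 1)ⁿ`. -/
theorem finrank_span_box_add_le_of_relation {x : Fin n → ℝ} {d : ℕ} {a : Fin n → ℕ}
    (had : ∀ i, a i ≤ d) {F : MvPolynomial (Fin n) ℚ} (hF : F ≠ 0)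
    (hFa : ∀ i, F.degreeOf i ≤ a i) (hFx : MvPolynomial.aeval x F = 0) :
    Module.finrank ℚ (Submodule.span ℚ (Set.range (boxMonomial x d))) + ∏ i, (d + 1 - a i) ≤
      (d + 1) ^ n := by
  classical
  rw [← Fintype.range_linearCombination ℚ (boxMonomial x d)]
  set Φ := Fintype.linearCombination ℚ (boxMonomial x d) with hΦ
  have hrank : Module.finrank ℚ (LinearMap.range Φ) + Module.finrank ℚ (LinearMap.ker Φ) =
      (d + 1) ^ n := by
    rw [LinearMap.finrank_range_add_finrank_ker Φ, Module.finrank_fintype_fun_eq_card,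
      Fintype.card_fun, Fintype.card_fin, Fintype.card_fin]
  rw [← hrank]
  apply Nat.add_le_add_left
  -- the injective relation map into `ker Φ`
  have hker : ∀ c, relationMap d a F c ∈ LinearMap.ker Φ := relationMap_mem_ker had hFa hFx
  have hinj : Function.Injective (LinearMap.codRestrict (LinearMap.ker Φ) (relationMap d a F) hker) :=
    fun c c' h => relationMap_injective had hF hFa (congrArg Subtype.val h)
  have key := LinearMap.finrank_le_finrank_of_injective hinj
  rw [Module.finrank_fintype_fun_eq_card, Fintype.card_pi] at key
  simpa only [Fintype.card_fin] using key

end BoxAlgebra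

/-! ### §4 Door (N) graded by multidegree -/

section Doors

variable {n : ℕ}

/-- **Door (N), graded (any `n`).**  Nesterenko data on `Box_d(x)` with
`(d+1)ⁿ − ∏ᵢ (d+1−aᵢ) < 1 + τ` exclude every relation `F(x) = 0` of multidegree `≤ a`
(`a ≤ (d,…,d)`). -/
theorem eq_zero_of_box_nesterenkoData {x : Fin n → ℝ} {d : ℕ} {a : Fin n → ℕ}
    (had : ∀ i, a i ≤ d) {α β : ℝ} {p : ℕ → (Fin n → Fin (d + 1)) → ℤ}
    (hα : 0 < α) (hα1 : α < 1) (hβ : 1 < β) (hp : p ∈ nesterenkoData (boxMonomial x d) α β)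
    (hτ : (((d + 1) ^ n - ∏ i, (d + 1 - a i) : ℕ) : ℝ) < 1 - Real.log α / Real.log β)
    {F : MvPolynomial (Fin n) ℚ} (hFa : ∀ i, F.degreeOf i ≤ a i)
    (hFx : MvPolynomial.aeval x F = 0) : F = 0 := by
  by_contra hF
  have hcap := finrank_span_box_add_le_of_relation had hF hFa hFx
  have hN := finrank_ge_of_mem_nesterenkoData (boxMonomial x d) hα hα1 hβ hp
  have h1 : Module.finrank ℚ (Submodule.span ℚ (Set.range (boxMonomial x d))) ≤
      (d + 1) ^ n - ∏ i, (d + 1 - a i) := by omega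
  have h2 : (Module.finrank ℚ (Submodule.span ℚ (Set.range (boxMonomial x d))) : ℝ) ≤
      (((d + 1) ^ n - ∏ i, (d + 1 - a i) : ℕ) : ℝ) := by exact_mod_cast h1
  linarith

/-- **Door (N), graded, two variables.**  Nesterenko data on `Box_d(x)`, `x ∈ ℝ²`, with
`(a + b)(d + 1) − ab < 1 + τ` (`a, b ≤ d`) exclude every relation of bidegree `≤ (a, b)`. -/
theorem eq_zero_of_box_nesterenkoData_two {x : Fin 2 → ℝ} {d a b : ℕ} (ha : a ≤ d) (hb : b ≤ d)
    {α β : ℝ} {p : ℕ → (Fin 2 → Fin (d + 1)) → ℤ} (hα : 0 < α) (hα1 : α < 1) (hβ : 1 < β)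
    (hp : p ∈ nesterenkoData (boxMonomial x d) α β)
    (hτ : ((a + b) * (d + 1) : ℝ) - a * b < 1 - Real.log α / Real.log β)
    {F : MvPolynomial (Fin 2) ℚ} (hFa : F.degreeOf 0 ≤ a) (hFb : F.degreeOf 1 ≤ b)
    (hFx : MvPolynomial.aeval x F = 0) : F = 0 := by
  have had : ∀ i : Fin 2, (![a, b] : Fin 2 → ℕ) i ≤ d := fun i => by
    fin_cases i
    · simpa using ha
    · simpa using hb
  have hFab : ∀ i : Fin 2, F.degreeOf i ≤ (![a, b] : Fin 2 → ℕ) i := fun i => by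
    fin_cases i
    · simpa using hFa
    · simpa using hFb
  refine eq_zero_of_box_nesterenkoData had hα hα1 hβ hp ?_ hFab hFx
  have hprod : ∏ i : Fin 2, (d + 1 - (![a, b] : Fin 2 → ℕ) i) = (d + 1 - a) * (d + 1 - b) := by
    rw [Fin.prod_univ_two]
    rfl
  have hle : (d + 1 - a) * (d + 1 - b) ≤ (d + 1) ^ 2 := by
    rw [sq]
    exact Nat.mul_le_mul (Nat.sub_le _ _) (Nat.sub_le _ _)
  have hcast : (((d + 1) ^ 2 - ∏ i : Fin 2, (d + 1 - (![a, b] : Fin 2 → ℕ) i) : ℕ) : ℝ) =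
      ((a + b) * (d + 1) : ℝ) - a * b := by
    rw [hprod, Nat.cast_sub hle, Nat.cast_mul, Nat.cast_sub (by omega : a ≤ d + 1),
      Nat.cast_sub (by omega : b ≤ d + 1)]
    push_cast
    ring
  rwa [hcast]

/-- **Door (N)(a″): `τ_d > 2d` on ONE box gives the bilinear floor.**  Nesterenko data on
`Box_d(e, π)` (any `d ≥ 1`) with `2d + 1 < 1 + τ_d` give `BilinearFloor` — a relation of
bidegree `≤ (1,1)` would cap `dim Box_d(e,π)` at `2d + 1`.  (`d = 1` is door (N)(a′):
`3 < 1 + τ`.) -/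
theorem bilinearFloor_of_box_nesterenkoData {d : ℕ} (hd : 1 ≤ d) {α β : ℝ}
    {p : ℕ → (Fin 2 → Fin (d + 1)) → ℤ} (hα : 0 < α) (hα1 : α < 1) (hβ : 1 < β)
    (hp : p ∈ nesterenkoData (boxMonomial ![Real.exp 1, Real.pi] d) α β)
    (hτ : (2 * d + 1 : ℝ) < 1 - Real.log α / Real.log β) : BilinearFloor := by
  rw [bilinearFloor_iff_box_one, box_linearIndependent_iff_forall_eq_zero]
  intro P hP hPx
  refine eq_zero_of_box_nesterenkoData_two hd hd hα hα1 hβ hp ?_ (hP 0) (hP 1) hPx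
  push_cast
  linarith

/-- **Door (N)(b′): graded families give `e ⟂ π`.**  If for every bidegree `(a, b)` some box
`Box_d(e, π)` with `d ≥ a, b` carries Nesterenko data with `(a+b)(d+1) − ab < 1 + τ`, then `e`
and `π` are algebraically independent.  (Door (N)(b) is the square case `a = b = d`, threshold
`(d+1)² − 1`.) -/
theorem expOnePiAlgebraicIndependent_of_graded_nesterenkoData
    (h : ∀ a b : ℕ, ∃ d : ℕ, a ≤ d ∧ b ≤ d ∧ ∃ α β : ℝ, ∃ p : ℕ → (Fin 2 → Fin (d + 1)) → ℤ,
      0 < α ∧ α < 1 ∧ 1 < β ∧ p ∈ nesterenkoData (boxMonomial ![Real.exp 1, Real.pi] d) α β ∧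
        ((a + b) * (d + 1) : ℝ) - a * b < 1 - Real.log α / Real.log β) :
    ExpOnePiAlgebraicIndependent := by
  rw [ExpOnePiAlgebraicIndependent, algebraicIndependent_iff]
  intro P hPx
  obtain ⟨d, ha, hb, α, β, p, hα, hα1, hβ, hp, hτ⟩ := h (P.degreeOf 0) (P.degreeOf 1)
  exact eq_zero_of_box_nesterenkoData_two ha hb hα hα1 hβ hp hτ le_rfl le_rfl hPx

end Doors

end Summit.Schanuel.Schanuel.Theorems

end
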